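import Summits.CriticalPhenomena.SAWScalingLimit.Theorems.MassRatio.Negative.Tools

/-!
# Crux `MassRatio` (stmt-CriticalPhenomena-8550) — load-bearing hypotheses, part 19: star algebra at a full interior star — `star_identity` (the vertex relation inverts to `3F_t = S + ω^t T'`), `star_norm_bounds`, the honeycomb star in coordinates (`star_up`, `star_down`, `filter_adj_up/_down`)

Negative knowledge on the crux `MassRatio` (stmt-CriticalPhenomena-8550, route SAWDefectDecoherence r3),
written by the standing disprover (cdisprove, cycles 1–4). The series `MassRatio/Negative/*` does NOT
refute the crux (verdict: RESISTS — it is a pure exponent bet, predicted ratio `δ^{-25/48}` against the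
cut `δ^{-3/4}`); it proves which hypotheses of the crux are LOAD-BEARING (rows clause, `0 < ρ`,
`δ·mid(b_δ) → b`, exhaustion of compacts: each deleted ⇒ FALSE, by explicit admissible families in the
rectangle `D₀ = (-2,2)×(-1,1)` whose boundary mass at the target edge is starved EXACTLY by a bare
corridor), that the hypothesis frame is satisfiable (`massRatio_frame_nonvacuous`), and that the
`Nonempty`-SAW clause is implied by the others. Mechanism throughout: on a bare root-attached corridor
the self-avoiding walk is unique, so `|Z| = x_c^{length}` exactly, while a staircase walk certifies
`|Z(e₀)| ≥ x_c^{2 iK + 1}` at a mid-edge `e₀` of the compact `Kbox`; `x_c < 3/5` and Bernoulli finish.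
-/

namespace Summit.CriticalPhenomena.SAWScalingLimit.Theorems.MassRatio.Negative

open Literature.Probability.LatticeModels Literature.Probability.RandomPlanarGeometry.SAW
open Literature.Probability.RandomPlanarGeometry
open Summit.CriticalPhenomena.SAWScalingLimit.Theses.SAWDefectDecoherence

/-! ### J.2 Star algebra: the vertex relation makes the three edge values nearly equal -/

/-- `x_c` unfolds to `1/√(2+√2)` (to rewrite the vendored form of Lemma 1). [folklore] -/
theorem xc_def : hexCriticalFugacity = (Real.sqrt (2 + Real.sqrt 2))⁻¹ := rfl

/-- A primitive cube root of unity has norm one. [folklore] -/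
theorem norm_eq_one_of_cube_root {ω : ℂ} (hω : 1 + ω + ω ^ 2 = 0) : ‖ω‖ = 1 := by
  have h3 : ω ^ 3 = 1 := by linear_combination (ω - 1) * hω
  have : ‖ω‖ ^ 3 = 1 := by rw [← norm_pow, h3, norm_one]
  exact (pow_eq_one_iff_of_nonneg (norm_nonneg ω) (by norm_num)).1 this

/-- **Inverse DFT at a star.** If `F₀ + ω F₁ + ω² F₂ = 0` (the vertex relation with the common
direction factor `d₀` cancelled, `ω` a primitive cube root of unity), then with the plain star sum
`S = F₀ + F₁ + F₂` and the conjugate-twisted sum `T' = F₀ + ω² F₁ + ω F₂` one has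
`3 F_t = S + ω^t T'` for `t = 0, 1, 2`. [folklore] -/
theorem star_identity {F₀ F₁ F₂ ω : ℂ} (hω : 1 + ω + ω ^ 2 = 0)
    (hVR : F₀ + ω * F₁ + ω ^ 2 * F₂ = 0) :
    3 * F₀ = (F₀ + F₁ + F₂) + (F₀ + ω ^ 2 * F₁ + ω * F₂) ∧
    3 * F₁ = (F₀ + F₁ + F₂) + ω * (F₀ + ω ^ 2 * F₁ + ω * F₂) ∧
    3 * F₂ = (F₀ + F₁ + F₂) + ω ^ 2 * (F₀ + ω ^ 2 * F₁ + ω * F₂) := by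
  refine ⟨?_, ?_, ?_⟩
  · linear_combination hVR - (F₁ + F₂) * hω
  · linear_combination ω ^ 2 * hVR + (-F₀ - 2 * (ω - 1) * F₁ - (1 - ω + ω ^ 2) * F₂) * hω
  · linear_combination ω * hVR + (-F₀ - (1 - ω + ω ^ 2) * F₁ - 2 * (ω - 1) * F₂) * hω

/-- **Two-sided comparison of the plain star sum with the sum of moduli**, given the vertex
relation: `Σ_t |F_t| - |T'| ≤ |S| ≤ Σ_t |F_t|` and `Σ_t |F_t| ≤ |S| + |T'|`. [folklore] -/
theorem star_norm_bounds {F₀ F₁ F₂ ω : ℂ} (hω : 1 + ω + ω ^ 2 = 0)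
    (hVR : F₀ + ω * F₁ + ω ^ 2 * F₂ = 0) :
    ‖F₀‖ + ‖F₁‖ + ‖F₂‖ ≤ ‖F₀ + F₁ + F₂‖ + ‖F₀ + ω ^ 2 * F₁ + ω * F₂‖ ∧
    ‖F₀‖ + ‖F₁‖ + ‖F₂‖ - ‖F₀ + ω ^ 2 * F₁ + ω * F₂‖ ≤ ‖F₀ + F₁ + F₂‖ := by
  obtain ⟨h0, h1, h2⟩ := star_identity hω hVR
  have hn := norm_eq_one_of_cube_root hω
  set S := F₀ + F₁ + F₂
  set T := F₀ + ω ^ 2 * F₁ + ω * F₂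
  have e0 : ‖3 * F₀‖ = 3 * ‖F₀‖ := by rw [norm_mul]; norm_num
  have e1 : ‖3 * F₁‖ = 3 * ‖F₁‖ := by rw [norm_mul]; norm_num
  have e2 : ‖3 * F₂‖ = 3 * ‖F₂‖ := by rw [norm_mul]; norm_num
  have nT1 : ‖ω * T‖ = ‖T‖ := by rw [norm_mul, hn, one_mul]
  have nT2 : ‖ω ^ 2 * T‖ = ‖T‖ := by rw [norm_mul, norm_pow, hn, one_pow, one_mul]
  -- upper bounds `3|F_t| ≤ |S| + |T|`
  have u0 : 3 * ‖F₀‖ ≤ ‖S‖ + ‖T‖ := by rw [← e0, h0]; exact norm_add_le _ _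
  have u1 : 3 * ‖F₁‖ ≤ ‖S‖ + ‖T‖ := by rw [← e1, h1, ← nT1]; exact norm_add_le _ _
  have u2 : 3 * ‖F₂‖ ≤ ‖S‖ + ‖T‖ := by rw [← e2, h2, ← nT2]; exact norm_add_le _ _
  -- lower bounds `|S| ≥ 3|F_t| - |T|`
  have l0 : 3 * ‖F₀‖ - ‖T‖ ≤ ‖S‖ := by
    have : ‖3 * F₀‖ ≤ ‖S‖ + ‖T‖ := by rw [h0]; exact norm_add_le _ _
    have hS : S = 3 * F₀ - T := by rw [h0]; ring
    have := norm_sub_le (3 * F₀) T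
    rw [← hS, e0] at this
    linarith
  have l1 : 3 * ‖F₁‖ - ‖T‖ ≤ ‖S‖ := by
    have hS : S = 3 * F₁ - ω * T := by rw [h1]; ring
    have := norm_sub_le (3 * F₁) (ω * T)
    rw [← hS, e1, nT1] at this
    linarith
  have l2 : 3 * ‖F₂‖ - ‖T‖ ≤ ‖S‖ := by
    have hS : S = 3 * F₂ - ω ^ 2 * T := by rw [h2]; ring
    have := norm_sub_le (3 * F₂) (ω ^ 2 * T)
    rw [← hS, e2, nT2] at this
    linarith
  constructor <;> linarith

/-! ### J.3 The honeycomb star in coordinates -/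

/-- `ζ³ = -1`. [folklore] -/
theorem triZeta_cube : triZeta ^ 3 = -1 := by
  have h := triZeta_sq
  linear_combination (triZeta + 1) * h

/-- `ω = ζ²` is a primitive cube root of unity: `1 + ζ² + ζ⁴ = 0`. [folklore] -/
theorem one_add_zsq_add : 1 + triZeta ^ 2 + (triZeta ^ 2) ^ 2 = 0 := by
  have h := triZeta_sq
  linear_combination (triZeta ^ 2 + triZeta + 1) * h

/-- `conj ζ = 1 - ζ` (`ζ = 1/2 + i√3/2`). [folklore] -/
theorem conj_triZeta : (starRingEnd ℂ) triZeta = 1 - triZeta := by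
  apply Complex.ext
  · simp; norm_num
  · simp

/-- `conj (ζ²) = ζ⁴` (complex conjugation inverts cube roots of unity). [folklore] -/
theorem conj_zsq : (starRingEnd ℂ) (triZeta ^ 2) = (triZeta ^ 2) ^ 2 := by
  rw [map_pow, conj_triZeta]
  have h := triZeta_sq
  linear_combination (-(triZeta ^ 2) - triZeta + 1) * h

/-- `1 + ζ ≠ 0`. [folklore] -/
theorem one_add_triZeta_ne : (1 : ℂ) + triZeta ≠ 0 := by
  intro h
  have := congrArg Complex.im h
  simp at this

/-- `|1 + ζ|² = 3`. [folklore] -/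
theorem normSq_one_add_triZeta : Complex.normSq (1 + triZeta) = 3 := by
  have h := normSq_add_mul_triZeta 1 1
  push_cast at h
  rw [one_mul] at h
  rw [h]; norm_num

/-- `‖(1 + ζ)/6‖ = 1/(2√3)`, written as `‖(1+ζ)/6‖ * (2 √3) = 1`. [folklore] -/
theorem norm_one_add_triZeta : ‖(1 : ℂ) + triZeta‖ = Real.sqrt 3 := by
  rw [← Real.sqrt_sq (norm_nonneg _), Complex.sq_norm, normSq_one_add_triZeta]

/-- `norm_d₀_mul`: star-algebra lemma (MassRatio negative series). [folklore] -/
theorem norm_d₀_mul : ‖(1 + triZeta) / 6‖ * (2 * Real.sqrt 3) = 1 := by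
  rw [norm_div, norm_one_add_triZeta]
  have h3 : Real.sqrt 3 * Real.sqrt 3 = 3 := Real.mul_self_sqrt (by norm_num)
  have h6 : ‖(6:ℂ)‖ = 6 := by simp
  rw [h6]
  nlinarith [h3]

/-- The three neighbours of an up face `(y, 0)` and their half-displacements
`mid{v,t} - c_v = (1+ζ)/6 · ω^t`, `ω = ζ²`. [folklore] -/
theorem star_up (y : Site 2) :
    hexGraph.Adj (y, 0) (y, 1) ∧ hexGraph.Adj (y, 0) (y - Pi.single 0 1, 1) ∧
      hexGraph.Adj (y, 0) (y - Pi.single 1 1, 1) ∧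
    (y, (1 : Fin 2)) ≠ (y - Pi.single 0 1, 1) ∧
      (y - Pi.single 0 1, (1 : Fin 2)) ≠ (y - Pi.single 1 1, 1) ∧
      (y, (1 : Fin 2)) ≠ (y - Pi.single 1 1, 1) ∧
    hexMidpoint s(((y, 0) : HexVertex), (y, 1)) - hexCenter (y, 0) = (1 + triZeta) / 6 ∧
    hexMidpoint s(((y, 0) : HexVertex), (y - Pi.single 0 1, 1)) - hexCenter (y, 0) =
      (1 + triZeta) / 6 * triZeta ^ 2 ∧
    hexMidpoint s(((y, 0) : HexVertex), (y - Pi.single 1 1, 1)) - hexCenter (y, 0) =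
      (1 + triZeta) / 6 * (triZeta ^ 2) ^ 2 := by
  have hsq := triZeta_sq
  refine ⟨?_, ?_, ?_, ?_, ?_, ?_, ?_, ?_, ?_⟩
  · exact (hexGraph_adj_iff_of_snd_eq_zero_holds y y).2 (Or.inl rfl)
  · exact (hexGraph_adj_iff_of_snd_eq_zero_holds y _).2 (Or.inr (Or.inl rfl))
  · exact (hexGraph_adj_iff_of_snd_eq_zero_holds y _).2 (Or.inr (Or.inr rfl))
  · intro h
    have h' := congrArg (fun v : HexVertex => v.1 0) h
    simp at h'
    omega
  · intro h
    have h' := congrArg (fun v : HexVertex => v.1 0) h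
    simp at h'
  · intro h
    have h' := congrArg (fun v : HexVertex => v.1 1) h
    simp at h'
    omega
  · simp only [hexMidpoint_mk, hexCenter, Fin.val_zero, Fin.val_one, Nat.cast_zero, Nat.cast_one]
    ring
  · simp only [hexMidpoint_mk, hexCenter, Fin.val_zero, Fin.val_one, Nat.cast_zero, Nat.cast_one,
      triEmbed_sub, triEmbed_single_zero]
    linear_combination ((-triZeta - 2) / 6) * hsq
  · simp only [hexMidpoint_mk, hexCenter, Fin.val_zero, Fin.val_one, Nat.cast_zero, Nat.cast_one,
      triEmbed_sub, triEmbed_single_one]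
    linear_combination ((-triZeta ^ 3 - 2 * triZeta ^ 2 - triZeta + 1) / 6) * hsq

/-- The three neighbours of a down face `(y, 1)` and their half-displacements
`mid{v,t} - c_v = -(1+ζ)/6 · ω^t`. [folklore] -/
theorem star_down (y : Site 2) :
    hexGraph.Adj (y, 1) (y, 0) ∧ hexGraph.Adj (y, 1) (y + Pi.single 0 1, 0) ∧
      hexGraph.Adj (y, 1) (y + Pi.single 1 1, 0) ∧
    (y, (0 : Fin 2)) ≠ (y + Pi.single 0 1, 0) ∧
      (y + Pi.single 0 1, (0 : Fin 2)) ≠ (y + Pi.single 1 1, 0) ∧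
      (y, (0 : Fin 2)) ≠ (y + Pi.single 1 1, 0) ∧
    hexMidpoint s(((y, 1) : HexVertex), (y, 0)) - hexCenter (y, 1) = -(1 + triZeta) / 6 ∧
    hexMidpoint s(((y, 1) : HexVertex), (y + Pi.single 0 1, 0)) - hexCenter (y, 1) =
      -(1 + triZeta) / 6 * triZeta ^ 2 ∧
    hexMidpoint s(((y, 1) : HexVertex), (y + Pi.single 1 1, 0)) - hexCenter (y, 1) =
      -(1 + triZeta) / 6 * (triZeta ^ 2) ^ 2 := by
  have hsq := triZeta_sq
  refine ⟨?_, ?_, ?_, ?_, ?_, ?_, ?_, ?_, ?_⟩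
  · exact (hexGraph_adj_iff_of_snd_eq_one y y).2 (Or.inl rfl)
  · exact (hexGraph_adj_iff_of_snd_eq_one y _).2 (Or.inr (Or.inl rfl))
  · exact (hexGraph_adj_iff_of_snd_eq_one y _).2 (Or.inr (Or.inr rfl))
  · intro h
    have h' := congrArg (fun v : HexVertex => v.1 0) h
    simp at h'
  · intro h
    have h' := congrArg (fun v : HexVertex => v.1 0) h
    simp at h'
  · intro h
    have h' := congrArg (fun v : HexVertex => v.1 1) h
    simp at h'
  · simp only [hexMidpoint_mk, hexCenter, Fin.val_zero, Fin.val_one, Nat.cast_zero, Nat.cast_one]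
    ring
  · simp only [hexMidpoint_mk, hexCenter, Fin.val_zero, Fin.val_one, Nat.cast_zero, Nat.cast_one,
      triEmbed_add, triEmbed_single_zero]
    linear_combination ((triZeta + 2) / 6) * hsq
  · simp only [hexMidpoint_mk, hexCenter, Fin.val_zero, Fin.val_one, Nat.cast_zero, Nat.cast_one,
      triEmbed_add, triEmbed_single_one]
    linear_combination ((triZeta ^ 3 + 2 * triZeta ^ 2 + triZeta - 1) / 6) * hsq

/-- Adjacent centres are at distance `≤ 1` (exactly `1/√3`). [folklore] -/
theorem dist_center_le_one {v t : HexVertex} (h : hexGraph.Adj v t) :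
    dist (hexCenter t) (hexCenter v) ≤ 1 := by
  -- `c_t - c_v = 2 (mid{v,t} - c_v)` and `|mid - c_v| = |1+ζ|/6`
  have key : ∀ {d₀ : ℂ}, ‖d₀‖ * (2 * Real.sqrt 3) = 1 →
      hexMidpoint s(v, t) - hexCenter v = d₀ ∨ hexMidpoint s(v, t) - hexCenter v = d₀ * triZeta ^ 2 ∨
        hexMidpoint s(v, t) - hexCenter v = d₀ * (triZeta ^ 2) ^ 2 →
      dist (hexCenter t) (hexCenter v) ≤ 1 := by
    intro d₀ hd h3
    have hn1 : ‖triZeta ^ 2‖ = 1 := norm_eq_one_of_cube_root one_add_zsq_add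
    have hmid : hexCenter t - hexCenter v = 2 * (hexMidpoint s(v, t) - hexCenter v) := by
      rw [hexMidpoint_mk]; ring
    have hnorm : ‖hexMidpoint s(v, t) - hexCenter v‖ = ‖d₀‖ := by
      rcases h3 with h | h | h <;> rw [h]
      · rw [norm_mul, hn1, mul_one]
      · rw [norm_mul, norm_pow, hn1, one_pow, mul_one]
    rw [dist_eq_norm, hmid, norm_mul, hnorm]
    have hs3 : (17:ℝ) / 10 < Real.sqrt 3 := sqrt3_gt
    have : ‖(2:ℂ)‖ = 2 := by simp
    rw [this]
    nlinarith [norm_nonneg d₀]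
  obtain ⟨y, i⟩ := v
  obtain ⟨z, j⟩ := t
  fin_cases i <;> fin_cases j
  · exact absurd h (not_hexGraph_adj_of_snd_eq_holds _ _ rfl)
  · obtain ⟨-, -, -, -, -, -, hdp, hdq, hdr⟩ := star_up y
    rcases (hexGraph_adj_iff_of_snd_eq_zero_holds y z).1 h with rfl | rfl | rfl
    · exact key norm_d₀_mul (Or.inl hdp)
    · exact key norm_d₀_mul (Or.inr (Or.inl hdq))
    · exact key norm_d₀_mul (Or.inr (Or.inr hdr))
  · obtain ⟨-, -, -, -, -, -, hdp, hdq, hdr⟩ := star_down y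
    have hd' : ‖-(1 + triZeta) / 6‖ * (2 * Real.sqrt 3) = 1 := by
      rw [neg_div, norm_neg]; exact norm_d₀_mul
    rcases (hexGraph_adj_iff_of_snd_eq_one y z).1 h with rfl | rfl | rfl
    · exact key hd' (Or.inl hdp)
    · exact key hd' (Or.inr (Or.inl hdq))
    · exact key hd' (Or.inr (Or.inr hdr))
  · exact absurd h (not_hexGraph_adj_of_snd_eq_holds _ _ rfl)

/-- The `Λ`-star of an up face all of whose neighbours lie in `Λ`. [folklore] -/
theorem filter_adj_up {Λ : Finset HexVertex} {y : Site 2} (h1 : ((y, 1) : HexVertex) ∈ Λ)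
    (h2 : ((y - Pi.single 0 1, 1) : HexVertex) ∈ Λ)
    (h3 : ((y - Pi.single 1 1, 1) : HexVertex) ∈ Λ) :
    Λ.filter (fun t => hexGraph.Adj (y, 0) t) =
      {((y, 1) : HexVertex), (y - Pi.single 0 1, 1), (y - Pi.single 1 1, 1)} := by
  ext t
  rw [Finset.mem_filter, Finset.mem_insert, Finset.mem_insert, Finset.mem_singleton]
  constructor
  · rintro ⟨-, hadj⟩
    obtain ⟨z, j⟩ := t
    fin_cases j
    · exact absurd hadj (not_hexGraph_adj_of_snd_eq_holds _ _ rfl)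
    · rcases (hexGraph_adj_iff_of_snd_eq_zero_holds y z).1 hadj with rfl | rfl | rfl
      · exact Or.inl rfl
      · exact Or.inr (Or.inl rfl)
      · exact Or.inr (Or.inr rfl)
  · obtain ⟨hp, hq, hr, -⟩ := star_up y
    rintro (rfl | rfl | rfl)
    · exact ⟨h1, hp⟩
    · exact ⟨h2, hq⟩
    · exact ⟨h3, hr⟩

/-- The `Λ`-star of a down face all of whose neighbours lie in `Λ`. [folklore] -/
theorem filter_adj_down {Λ : Finset HexVertex} {y : Site 2} (h1 : ((y, 0) : HexVertex) ∈ Λ)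
    (h2 : ((y + Pi.single 0 1, 0) : HexVertex) ∈ Λ)
    (h3 : ((y + Pi.single 1 1, 0) : HexVertex) ∈ Λ) :
    Λ.filter (fun t => hexGraph.Adj (y, 1) t) =
      {((y, 0) : HexVertex), (y + Pi.single 0 1, 0), (y + Pi.single 1 1, 0)} := by
  ext t
  rw [Finset.mem_filter, Finset.mem_insert, Finset.mem_insert, Finset.mem_singleton]
  constructor
  · rintro ⟨-, hadj⟩
    obtain ⟨z, j⟩ := t
    fin_cases j
    · rcases (hexGraph_adj_iff_of_snd_eq_one y z).1 hadj with rfl | rfl | rfl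
      · exact Or.inl rfl
      · exact Or.inr (Or.inl rfl)
      · exact Or.inr (Or.inr rfl)
    · exact absurd hadj (not_hexGraph_adj_of_snd_eq_holds _ _ rfl)
  · obtain ⟨hp, hq, hr, -⟩ := star_down y
    rintro (rfl | rfl | rfl)
    · exact ⟨h1, hp⟩
    · exact ⟨h2, hq⟩
    · exact ⟨h3, hr⟩

end Summit.CriticalPhenomena.SAWScalingLimit.Theorems.MassRatio.Negative
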